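import Mathlib
import Summits.MatrixMultiplication.MatrixMultiplication.Theses.MatrixPointInterpolation
import Summits.MatrixMultiplication.MatrixMultiplication.Theorems.LongMasquerade.Negative.WindowedKaplanskyTwoLemmas

/-!
# `MatrixPointInterpolation.LongMasquerade` (stmt-MatrixMultiplication-18938) — Negative lane:
# the windowed Kaplansky theorem at point size `k = 2`

`LongMasquerade` asks for SOME point size `k ≥ 2` and masquerades of `M_k` inside `M_n(ℂ)` with
`n` unbounded: a pair `A₀, A₁ ∈ M_n(ℂ)` whose words of length `≤ d` span `M_n` while every
two-letter identity of `M_k(ℂ)` of degree `≤ 2d` vanishes at `(A₀, A₁)`.  This file closes the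
branch `k = 2` (the route's own "smallest honest case"): **no masquerade of `M₂` exists once
`n ≥ 6`** (`no_masquerade_two`), hence the `k = 2` instance of the crux is false
(`longMasquerade_two_false`) and the crux can only hold with `3 ≤ k`
(`longMasquerade_forces_three_le`).  The crux itself (`∃ k ≥ 2`) is NOT refuted here.

Mechanism (a "level-one" use of the window; the route's CHEAPEST FALSIFIER only ran plain
identities at `d ≤ 3`): Hall's central polynomial `[x,y]²` of `M₂`, partially polarised, gives
the degree-5 identity `[[x,y][z,y] + [z,y][x,y], t] = 0` of `M₂(ℂ)`.  Substituting `x ↦ w` (ANY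
word of length `≤ d`), `y ↦ x₀`, `z ↦ x₁`, `t ↦ xᵢ` costs degree `d + 4 ≤ 2d` (`d ≥ 4` is forced
by generation once `n ≥ 6`), so by the window `G(X) := [X,a]c + c[X,a]` (`a = A₀`, `b = A₁`,
`c = [b,a]`) commutes with `a` and `b` for every `X = w(A)`, hence (span) for every `X ∈ M_n`,
hence is scalar.  On rank-one `X = x yᵀ`, `G(X)` is a sum of four rank-one matrices, so it kills a
non-zero vector when `n ≥ 5`: the scalar is `0` and `G ≡ 0`.  The operator identity
`X(ac) − aXc + cXa − (ca)X = 0` then gives, against linear functionals separating `1, a, c`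
(`tensor_vanish4`), either `a ∈ span{1,c}` or `c ∈ span{1,a}`; both make `a, b` reducible
(commuting generators, or `[b,c] = βc` with `ker c` a common invariant subspace), contradicting
generation of `M_n`.
-/

namespace Summit.MatrixMultiplication.MatrixMultiplication.Theorems

open scoped BigOperators
open Matrix

namespace LongMasqueradeNeg

variable {n d : ℕ} {A : Fin 2 → Matrix (Fin n) (Fin n) ℂ}

/-- **Windowed Kaplansky at `k = 2`.** No pair `A₀, A₁ ∈ M_n(ℂ)` with `n ≥ 6` generates `M_n`
by words of length `≤ d` while all two-letter identities of `M₂(ℂ)` of degree `≤ 2d` vanish at it.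
(The argument gives `n ≤ 4`; `6 ≤ n` keeps the word count elementary.) [folklore] -/
theorem no_masquerade_two (hn : 6 ≤ n)
    (hspan : Submodule.span ℂ {M : Matrix (Fin n) (Fin n) ℂ |
      ∃ w : List (Fin 2), w.length ≤ d ∧ (w.map A).prod = M} = ⊤)
    (hmasq : ∀ (T : Finset (List (Fin 2))) (c : List (Fin 2) → ℂ), (∀ w ∈ T, w.length ≤ 2 * d) →
      (∀ B : Fin 2 → Matrix (Fin 2) (Fin 2) ℂ, (∑ w ∈ T, c w • (w.map B).prod) = 0) →
      (∑ w ∈ T, c w • (w.map A).prod) = 0) : False := by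
  classical
  -- Step 0: `d ≥ 4`, by counting words (`n² ≤ (d+1)·2^d`)
  have hd : 4 ≤ d := by
    by_contra hd
    push Not at hd
    let F : Fin (d + 1) × (Fin d → Fin 2) → Matrix (Fin n) (Fin n) ℂ :=
      fun p => (((List.ofFn p.2).take p.1).map A).prod
    have hsub : {M : Matrix (Fin n) (Fin n) ℂ | ∃ w : List (Fin 2), w.length ≤ d ∧ (w.map A).prod = M}
        ⊆ ((Finset.univ.image F : Finset (Matrix (Fin n) (Fin n) ℂ)) : Set (Matrix (Fin n) (Fin n) ℂ)) := by
      rintro M ⟨w, hw, rfl⟩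
      simp only [Finset.coe_image, Finset.coe_univ, Set.image_univ, Set.mem_range]
      refine ⟨(⟨w.length, by omega⟩, fun i => w[(i : ℕ)]?.getD 0), ?_⟩
      have hl : ((List.ofFn fun i : Fin d => w[(i : ℕ)]?.getD 0).take w.length) = w := by
        apply List.ext_getElem
        · simp; omega
        · intro k h1 h2
          simp [List.getElem?_eq_getElem h2]
      simp only [F, hl]
    have h1 : Module.finrank ℂ (Matrix (Fin n) (Fin n) ℂ) ≤ (Finset.univ.image F).card := by
      have hle := finrank_span_finset_le_card (R := ℂ) (Finset.univ.image F)
      rw [Set.finrank] at hle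
      rw [← finrank_top, ← hspan]
      exact (Submodule.finrank_mono (Submodule.span_mono hsub)).trans hle
    have h2 : (Finset.univ.image F).card ≤ (d + 1) * 2 ^ d :=
      Finset.card_image_le.trans (by simp)
    rw [Module.finrank_matrix, Fintype.card_fin, Module.finrank_self, mul_one] at h1
    have h3 : (d + 1) * 2 ^ d ≤ 32 := by interval_cases d <;> norm_num
    nlinarith
  set c : Matrix (Fin n) (Fin n) ℂ := A 1 * A 0 - A 0 * A 1 with hc
  -- the linear map `G(X) = [X,a]c + c[X,a]`
  let G : Matrix (Fin n) (Fin n) ℂ →ₗ[ℂ] Matrix (Fin n) (Fin n) ℂ :=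
    (LinearMap.mulRight ℂ c) ∘ₗ (LinearMap.mulRight ℂ (A 0) - LinearMap.mulLeft ℂ (A 0)) +
    (LinearMap.mulLeft ℂ c) ∘ₗ (LinearMap.mulRight ℂ (A 0) - LinearMap.mulLeft ℂ (A 0))
  have hGdef : ∀ X, G X = (X * A 0 - A 0 * X) * c + c * (X * A 0 - A 0 * X) := by
    intro X; simp [G]
  -- Step 1: `G X` commutes with the generators for every `X` (window + span)
  have hG : ∀ (X : Matrix (Fin n) (Fin n) ℂ) (i : Fin 2), G X * A i = A i * G X := by
    intro X i
    have hX : X ∈ Submodule.span ℂ {M : Matrix (Fin n) (Fin n) ℂ |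
        ∃ w : List (Fin 2), w.length ≤ d ∧ (w.map A).prod = M} := by
      rw [hspan]; exact Submodule.mem_top
    induction hX using Submodule.span_induction with
    | mem X hX =>
      obtain ⟨w, hw, rfl⟩ := hX
      rw [hGdef]
      exact hall_window hd hmasq w hw i
    | zero => simp
    | add X Y _ _ hX hY => rw [map_add, Matrix.add_mul, Matrix.mul_add, hX, hY]
    | smul r X _ hX => rw [map_smul, Matrix.smul_mul, Matrix.mul_smul, hX]
  -- Step 2: hence `G X` is scalar
  have hGs : ∀ X : Matrix (Fin n) (Fin n) ℂ, ∃ s : ℂ, G X = s • 1 :=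
    fun X => scalar_of_commute_gens hspan (hG X)
  -- Step 3: `G` vanishes on rank-one matrices (a kernel vector of four row vectors, `n ≥ 5`)
  have hG1 : ∀ x y : Fin n → ℂ, G (vecMulVec x y) = 0 := by
    intro x y
    obtain ⟨s, hs⟩ := hGs (vecMulVec x y)
    have e : G (vecMulVec x y) = vecMulVec x (y ᵥ* (A 0 * c)) - vecMulVec (A 0 *ᵥ x) (y ᵥ* c)
        + (vecMulVec (c *ᵥ x) (y ᵥ* A 0) - vecMulVec ((c * A 0) *ᵥ x) y) := by
      rw [hGdef]
      simp only [Matrix.sub_mul, Matrix.mul_sub, Matrix.vecMulVec_mul, Matrix.mul_vecMulVec,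
        Matrix.vecMul_vecMul, Matrix.mulVec_mulVec]
    let Q : Matrix (Fin 4) (Fin n) ℂ := Matrix.of ![y ᵥ* (A 0 * c), y ᵥ* c, y ᵥ* A 0, y]
    have hker : LinearMap.ker (Matrix.mulVecLin Q) ≠ ⊥ := by
      apply LinearMap.ker_ne_bot_of_finrank_lt
      simp only [Module.finrank_fintype_fun_eq_card, Fintype.card_fin]
      omega
    obtain ⟨z, hz, hz0⟩ := Submodule.exists_mem_ne_zero_of_ne_bot hker
    rw [LinearMap.mem_ker, Matrix.mulVecLin_apply] at hz
    have hq : ∀ j : Fin 4, (fun k => Q j k) ⬝ᵥ z = 0 := fun j => congrFun hz j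
    have hq0 : y ᵥ* (A 0 * c) ⬝ᵥ z = 0 := by simpa [Q] using hq 0
    have hq1 : y ᵥ* c ⬝ᵥ z = 0 := by simpa [Q] using hq 1
    have hq2 : y ᵥ* A 0 ⬝ᵥ z = 0 := by simpa [Q] using hq 2
    have hq3 : y ⬝ᵥ z = 0 := by simpa [Q] using hq 3
    have h0 : (s • (1 : Matrix (Fin n) (Fin n) ℂ)) *ᵥ z = 0 := by
      rw [← hs, e]
      simp [Matrix.sub_mulVec, Matrix.add_mulVec, Matrix.vecMulVec_mulVec, hq0, hq1, hq2, hq3]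
    rw [Matrix.smul_mulVec, Matrix.one_mulVec, smul_eq_zero] at h0
    rcases h0 with h0 | h0
    · rw [hs, h0, zero_smul]
    · exact absurd h0 hz0
  -- Step 4: `G ≡ 0`
  have hG0 : ∀ X : Matrix (Fin n) (Fin n) ℂ, G X = 0 := by
    intro X
    rw [Matrix.matrix_eq_sum_single X, map_sum]
    refine Finset.sum_eq_zero fun i _ => ?_
    rw [map_sum]
    refine Finset.sum_eq_zero fun j _ => ?_
    rw [show Matrix.single i j (X i j) = X i j • Matrix.single i j (1 : ℂ) by
      simp [Matrix.smul_single], map_smul, Matrix.single_eq_single_vecMulVec_single, hG1,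
      smul_zero]
  have hop : ∀ X : Matrix (Fin n) (Fin n) ℂ,
      1 * X * (A 0 * c) - A 0 * X * c + c * X * A 0 - (c * A 0) * X * 1 = 0 := by
    intro X
    have := hG0 X
    rw [hGdef] at this
    rw [← this]
    noncomm_ring
  -- Step 5: case analysis on the position of `a`, `c` against `span{1,c}`, `span{1,a}`
  by_cases hc0 : c = 0
  · exact false_of_commute (by omega) hspan (sub_eq_zero.1 (by rw [← hc, hc0])).symm
  by_cases hA : A 0 ∈ Submodule.span ℂ ({1, c} : Set (Matrix (Fin n) (Fin n) ℂ))
  · obtain ⟨α', β', hab⟩ := Submodule.mem_span_pair.1 hA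
    by_cases hβ' : β' = 0
    · apply false_of_commute (by omega) hspan
      rw [← hab, hβ', zero_smul, add_zero, Matrix.smul_mul, Matrix.mul_smul, Matrix.one_mul,
        Matrix.mul_one]
    · have h1 : c = β' • (A 1 * c - c * A 1) := by
        calc c = A 1 * A 0 - A 0 * A 1 := hc
          _ = A 1 * (α' • 1 + β' • c) - (α' • 1 + β' • c) * A 1 := by rw [hab]
          _ = β' • (A 1 * c - c * A 1) := by
            simp only [Matrix.mul_add, Matrix.add_mul, Matrix.mul_smul, Matrix.smul_mul,
              Matrix.mul_one, Matrix.one_mul, smul_sub]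
            abel
      have hbc : A 1 * c - c * A 1 = β'⁻¹ • c := by
        calc A 1 * c - c * A 1 = β'⁻¹ • (β' • (A 1 * c - c * A 1)) := by
              rw [inv_smul_smul₀ hβ']
          _ = β'⁻¹ • c := by rw [← h1]
      exact false_of_eigen hspan hc0 (inv_ne_zero hβ') hbc hab.symm
  by_cases hC : c ∈ Submodule.span ℂ ({1, A 0} : Set (Matrix (Fin n) (Fin n) ℂ))
  · obtain ⟨α', β', hcb⟩ := Submodule.mem_span_pair.1 hC
    by_cases hβ' : β' = 0
    · -- `c` scalar and traceless, hence `0`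
      have htr : Matrix.trace c = 0 := by
        rw [hc, Matrix.trace_sub, Matrix.trace_mul_comm, sub_self]
      rw [hβ', zero_smul, add_zero] at hcb
      have hα' : α' = 0 := by
        have := congrArg Matrix.trace hcb
        rw [Matrix.trace_smul, Matrix.trace_one, Fintype.card_fin, htr, smul_eq_mul] at this
        rcases mul_eq_zero.1 this with h | h
        · exact h
        · exfalso
          have hn' : (n : ℂ) ≠ 0 := by exact_mod_cast (show n ≠ 0 by omega)
          exact hn' h
      apply hc0
      rw [← hcb, hα', zero_smul]
    · apply hA
      rw [Submodule.mem_span_pair]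
      refine ⟨-(β'⁻¹ * α'), β'⁻¹, ?_⟩
      rw [← hcb, smul_add, smul_smul, smul_smul, inv_mul_cancel₀ hβ', one_smul, neg_smul,
        neg_add_cancel_left]
  -- Case A: functionals separating `1, a, c`
  obtain ⟨f, hfa, hf⟩ := Submodule.exists_dual_map_eq_bot_of_notMem hA inferInstance
  obtain ⟨g, hgc, hg⟩ := Submodule.exists_dual_map_eq_bot_of_notMem hC inferInstance
  have hf0 : ∀ x ∈ Submodule.span ℂ ({1, c} : Set (Matrix (Fin n) (Fin n) ℂ)), f x = 0 := by
    intro x hx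
    have : f x ∈ Submodule.map f (Submodule.span ℂ ({1, c} : Set (Matrix (Fin n) (Fin n) ℂ))) :=
      Submodule.mem_map_of_mem hx
    rwa [hf, Submodule.mem_bot] at this
  have hg0 : ∀ x ∈ Submodule.span ℂ ({1, A 0} : Set (Matrix (Fin n) (Fin n) ℂ)), g x = 0 := by
    intro x hx
    have : g x ∈ Submodule.map g (Submodule.span ℂ ({1, A 0} : Set (Matrix (Fin n) (Fin n) ℂ))) :=
      Submodule.mem_map_of_mem hx
    rwa [hg, Submodule.mem_bot] at this
  have hf1 : f 1 = 0 := hf0 1 (Submodule.subset_span (by simp))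
  have hfc : f c = 0 := hf0 c (Submodule.subset_span (by simp))
  have hg1 : g 1 = 0 := hg0 1 (Submodule.subset_span (by simp))
  have hga : g (A 0) = 0 := hg0 (A 0) (Submodule.subset_span (by simp))
  have key := tensor_vanish4 1 (A 0 * c) (A 0) c c (A 0) (c * A 0) 1 hop f g
  rw [hf1, hfc, hg1, zero_mul, zero_mul, mul_zero, zero_sub, add_zero, sub_zero,
    neg_eq_zero, mul_eq_zero] at key
  rcases key with h | h
  · exact hfa h
  · exact hgc h

end LongMasqueradeNeg

open Summit.MatrixMultiplication.MatrixMultiplication.Theses.MatrixPointInterpolation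
  (LongMasquerade)

/-- **The `k = 2` instance of `LongMasquerade` is false**: masquerades of `M₂(ℂ)` have bounded
size (`n ≤ 5` here; `n ≤ 4` with the sharp word count). [folklore] -/
theorem longMasquerade_two_false :
    ¬ (∀ n₀ : ℕ, ∃ (n d : ℕ) (A : Fin 2 → Matrix (Fin n) (Fin n) ℂ), n₀ ≤ n ∧
      Submodule.span ℂ {M : Matrix (Fin n) (Fin n) ℂ |
        ∃ w : List (Fin 2), w.length ≤ d ∧ (w.map A).prod = M} = ⊤ ∧
      ∀ (T : Finset (List (Fin 2))) (c : List (Fin 2) → ℂ), (∀ w ∈ T, w.length ≤ 2 * d) →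
        (∀ B : Fin 2 → Matrix (Fin 2) (Fin 2) ℂ, (∑ w ∈ T, c w • (w.map B).prod) = 0) →
        (∑ w ∈ T, c w • (w.map A).prod) = 0) := by
  intro h
  obtain ⟨n, d, A, hn, hspan, hmasq⟩ := h 6
  exact LongMasqueradeNeg.no_masquerade_two hn hspan hmasq

/-- Consequently `LongMasquerade` can only hold with point size `3 ≤ k`: the route's pivot
"a refutation only for `k = 2` forces `3 ≤ k`" is now in force. [folklore] -/
theorem longMasquerade_forces_three_le (h : LongMasquerade) :
    ∃ k : ℕ, 3 ≤ k ∧ ∀ n₀ : ℕ, ∃ (n d : ℕ) (A : Fin 2 → Matrix (Fin n) (Fin n) ℂ), n₀ ≤ n ∧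
      Submodule.span ℂ {M : Matrix (Fin n) (Fin n) ℂ |
        ∃ w : List (Fin 2), w.length ≤ d ∧ (w.map A).prod = M} = ⊤ ∧
      ∀ (T : Finset (List (Fin 2))) (c : List (Fin 2) → ℂ), (∀ w ∈ T, w.length ≤ 2 * d) →
        (∀ B : Fin 2 → Matrix (Fin k) (Fin k) ℂ, (∑ w ∈ T, c w • (w.map B).prod) = 0) →
        (∑ w ∈ T, c w • (w.map A).prod) = 0 := by
  obtain ⟨k, hk, hfam⟩ := h
  rcases Nat.lt_or_ge k 3 with hlt | hge
  · obtain rfl : k = 2 := by omega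
    exact absurd hfam longMasquerade_two_false
  · exact ⟨k, hge, hfam⟩

/-- The `k = 2` slice of `TightWindows` holds vacuously (no masquerade of `M₂` with `n ≥ 6`), for
every real exponent shift `ε` (no positivity needed). [folklore] -/
theorem tightWindows_two (ε : ℝ) :
    ∃ n₁ : ℕ, ∀ (n d : ℕ) (A : Fin 2 → Matrix (Fin n) (Fin n) ℂ), n₁ ≤ n →
      Submodule.span ℂ {M : Matrix (Fin n) (Fin n) ℂ |
        ∃ w : List (Fin 2), w.length ≤ d ∧ (w.map A).prod = M} = ⊤ →
      (∀ (T : Finset (List (Fin 2))) (c : List (Fin 2) → ℂ), (∀ w ∈ T, w.length ≤ 2 * d) →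
        (∀ B : Fin 2 → Matrix (Fin 2) (Fin 2) ℂ, (∑ w ∈ T, c w • (w.map B).prod) = 0) →
        (∑ w ∈ T, c w • (w.map A).prod) = 0) →
      (Module.finrank ℂ (Submodule.span ℂ {f : (Fin 2 → Matrix (Fin 2) (Fin 2) ℂ) →
        Matrix (Fin 2) (Fin 2) ℂ | ∃ w : List (Fin 2), w.length ≤ 2 * d ∧ f = fun B =>
          (w.map B).prod}) : ℝ) ≤ (n : ℝ) ^ ((2 : ℝ) + ε) :=
  ⟨6, fun _ _ _ hn hspan hmasq => (LongMasqueradeNeg.no_masquerade_two hn hspan hmasq).elim⟩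

end Summit.MatrixMultiplication.MatrixMultiplication.Theorems
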